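import Summits.HodgeConjecture.HodgeConjecture.Theorems.EndoscopicMiddleDegreeAlgebraicOrEnvelopedOfBetAlone
import Summits.HodgeConjecture.HodgeConjecture.Theorems.EndoscopicMiddleDegreeAlgebraicOrEnvelopedCoreHodgeClassesAlgebraicCalibration
import HarnessLib

/-!
# The route's TARGET is blockwise HC: `MiddleDegreeStep ⟺ (HC on pure ℚ-Hecke blocks) ∧ (HC on Hecke cores)`
# (crux `EndoscopicMiddleDegree.AlgebraicOrEnveloped`, stmt-HodgeConjecture-14943, line `core-splitting-ladder`, lead seat c5, cycle 4)

Calibration of the ONE registered stub of the line (`stub_coreHodgeClassesAlgebraic`, THE BET: HC for the classes `ε e` of Hecke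
CORES) against the route's target `MiddleDegreeStep` (HC in the middle degree `2n = 2(m+1)` of a compact `2n`-ball quotient
`X` carrying a `UnitaryBallQuotientDatum`, `m ∈ {1,2}`, granted HC in degree `2m`). All statements are fact-free (no named
Literature fact, no `CupProductAlgebraic`, no Hodge–Riemann) and spelled out verbatim (no definition):

* `middleDegreeStep_of_blocks` — **PureBlockHodgeClassesAlgebraic ∧ CoreHodgeClassesAlgebraic ⟹ MiddleDegreeStep.** A rational
  `(n,n)`-class `c` is the sum `Σ_ε ε c` of its components in the ℚ-BLOCKS `ε` of the Hecke algebra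
  `𝓗 = Algebra.adjoin ℂ (range T_g)` on `H²ⁿ(X(ℂ); ℂ)` (`stub_rationalBlocks`, p87916); each `ε c` is rational and `(n,n)`
  (`heckeHodgeType`, unconditional); a PURE block's `ε c` is algebraic by the first hypothesis, a KILLED impure block has `ε c = 0`
  (coefficient-conjugation sieve `stub_killedBarren`, p96373), an UN-KILLED impure block — a CORE — has `ε c` algebraic by the bet.
* `pureBlockHodgeClassesAlgebraic_of_middleDegreeStep`, with `coreHodgeClassesAlgebraic_of_middleDegreeStep` (p117875) —
  the converse directions (two lines each), whence `middleDegreeStep_iff_blocks` : **`MiddleDegreeStep ⟺ Pure ∧ Core`**.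
* `pureBlockHodgeClassesAlgebraic_of_isotypicMiddle` — **the pure half follows from the route's other live crux
  `IsotypicMiddleClassesAlgebraic`** (stmt-HodgeConjecture-14301): a pure block `ε` IS the action `P_γ` of an ALGEBRAIC class `γ`
  on `X ⊗ X` (`exists_algebraic_corrAction_eq_of_mem_adjoin`: Hecke ring + `stub_heckeGraphAlgebraic` p112869) at the complex
  orientation family, rationality-preserving (ℚ-block), `(n,n)`-valued (purity), fixing `ε e` (idempotency).
* `middleDegreeStep_of_isotypicMiddle_of_bet` — hence **target ⟸ 14301 ∧ bet** directly, with no passage through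
  `AlgebraicOrEnveloped` (14943), `OrthogonalEnveloped` (14300), `OrthogonalSplit`, `CupProductAlgebraic` or any
  orientation-family bookkeeping (compare the route's `closes h₁ (algebraicOrEnveloped_of_bet hB) hS`, p119631).

Reading for the planner (promote / re-line decision on 14943): the deciding content of route EndoscopicMiddleDegree is EXACTLY two
Hodge-conjecture statements about ℚ-Hecke blocks of `H²ⁿ` — pure blocks (the p-adic / supersingular-seed attack of 14301 applies to
them verbatim and to nothing else on the deciding path) and cores (the bet; no attack in print: BMM Thm. 1 / Cor. 2 stop below the
middle degree) — and the target is their conjunction in the kernel. Nothing here attacks either half.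

References: BMM arXiv:1306.1515 Part 2 §1.8–1.9, Thm. 61; Arancibia–Moeglin–Renard arXiv:1507.01432 §8; Shimura 1971 §3.1.
-/

noncomputable section
set_option linter.dupNamespace false -- `Summit.<P>.<Sub>.Theorems.…` repeats `HodgeConjecture` (single-conjunct summit)

namespace Summit.HodgeConjecture.HodgeConjecture.Theorems.CoreSplittingLadder

open scoped BigOperators
open CategoryTheory MonoidalCategory CartesianMonoidalCategory
open Literature.AlgebraicGeometry.Motives (SchemeOver ComplexPoints IsSmoothProjective)
open Literature.AlgebraicGeometry.HodgeTheory
open Literature.AlgebraicGeometry.ShimuraVarieties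
open Literature.AlgebraicTopology.SingularHomology
open Summit.HodgeConjecture.HodgeConjecture.Theses.EndoscopicMiddleDegree
  (MiddleDegreeStep IsotypicMiddleClassesAlgebraic)
open Summit.HodgeConjecture.HodgeConjecture.Cruxes.MiddleThetaSpan.ConjugateDimensionSieve (IsPrimitiveCentralIdempotent)
open Summit.HodgeConjecture.HodgeConjecture.Cruxes.OrthogonalEnveloped.ImpureBarrenEnvelope (stub_rationalBlocks)
open Summit.HodgeConjecture.HodgeConjecture.Cruxes.OrthogonalEnveloped.PuritySortedHeckeEnvelope
  (stub_killedBarren heckeHodgeType)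
open Summit.HodgeConjecture.HodgeConjecture.Theorems.EndoscopicMiddleDegreeAlgebraicOrEnvelopedCoreHodgeClassesAlgebraicCalibration
  (coreHodgeClassesAlgebraic_of_middleDegreeStep)

/-! ## Blockwise HC at one datum -/

/-- **Middle-degree HC at one datum from HC on its pure blocks and on its cores** (pointwise form, no `hlow`). If every PURE
ℚ-block and every CORE of the Hecke algebra on `H²ⁿ(X(ℂ); ℂ)` maps every rational `(n,n)`-class into `algebraicClasses X n`, then
every rational `(n,n)`-class `c` is algebraic: `c = Σ_ε ε c` over the ℚ-blocks (`stub_rationalBlocks`); killed impure blocks vanish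
on `c` (`stub_killedBarren` fed `heckeHodgeType`). [cite: BergeronMillsonMoeglin2016Balls, Part 2 §1.9 and Thm. 61]
[cite: ArancibiaMoeglinRenard2015, §8] -/
theorem mem_algebraicClasses_of_pure_of_cores {m : ℕ} {X : SchemeOver ℂ} (D : UnitaryBallQuotientDatum (2 * (m + 1)) X)
    (hm1 : 1 ≤ m) (hm2 : m ≤ 2)
    (hPure : ∀ ε : Module.End ℂ (complexBetti X (2 * (m + 1))),
        ε ∈ Algebra.adjoin ℂ (Set.range (D.heckeCorrespondenceAction (2 * (m + 1)))) →
        ε * ε = ε →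
        (∀ T ∈ Algebra.adjoin ℂ (Set.range (D.heckeCorrespondenceAction (2 * (m + 1)))),
          T * ε = ε * T) →
        (∀ β, IsRationalClass β → IsRationalClass (ε β)) →
        (∀ (p q : ℕ) (x : complexBetti X (2 * (m + 1))), IsOfHodgeType (2 * (m + 1)) X (2 * (m + 1)) p q x →
          IsOfHodgeType (2 * (m + 1)) X (2 * (m + 1)) p q (ε x)) →
        (∀ f ∈ Algebra.adjoin ℂ (Set.range (D.heckeCorrespondenceAction (2 * (m + 1)))),
          f * f = f →
          (∀ T ∈ Algebra.adjoin ℂ (Set.range (D.heckeCorrespondenceAction (2 * (m + 1)))),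
            T * f = f * T) →
          (∀ β, IsRationalClass β → IsRationalClass (f β)) → f * ε = 0 ∨ f * ε = ε) →
        (∀ β, IsOfHodgeType (2 * (m + 1)) X (2 * (m + 1)) (m + 1) (m + 1) (ε β)) →
        ∀ e : complexBetti X (2 * (m + 1)), IsRationalClass e →
          IsOfHodgeType (2 * (m + 1)) X (2 * (m + 1)) (m + 1) (m + 1) e →
          ε e ∈ algebraicClasses X (m + 1))
    (hCore : ∀ ε : Module.End ℂ (complexBetti X (2 * (m + 1))),
        ε ∈ Algebra.adjoin ℂ (Set.range (D.heckeCorrespondenceAction (2 * (m + 1)))) →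
        ε * ε = ε →
        (∀ T ∈ Algebra.adjoin ℂ (Set.range (D.heckeCorrespondenceAction (2 * (m + 1)))),
          T * ε = ε * T) →
        (∀ β, IsRationalClass β → IsRationalClass (ε β)) →
        (∀ (p q : ℕ) (x : complexBetti X (2 * (m + 1))), IsOfHodgeType (2 * (m + 1)) X (2 * (m + 1)) p q x →
          IsOfHodgeType (2 * (m + 1)) X (2 * (m + 1)) p q (ε x)) →
        (∀ f ∈ Algebra.adjoin ℂ (Set.range (D.heckeCorrespondenceAction (2 * (m + 1)))),
          f * f = f →
          (∀ T ∈ Algebra.adjoin ℂ (Set.range (D.heckeCorrespondenceAction (2 * (m + 1)))),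
            T * f = f * T) →
          (∀ β, IsRationalClass β → IsRationalClass (f β)) → f * ε = 0 ∨ f * ε = ε) →
        (∃ β, ¬ IsOfHodgeType (2 * (m + 1)) X (2 * (m + 1)) (m + 1) (m + 1) (ε β)) →
        (∃ z : Module.End ℂ (complexBetti X (2 * (m + 1))),
          IsPrimitiveCentralIdempotent
              (Algebra.adjoin ℂ (Set.range (D.heckeCorrespondenceAction (2 * (m + 1))))) z ∧
            z * ε = z ∧
              ∀ σ : ℂ ≃+* ℂ, ∃ c : complexBetti X (2 * (m + 1)),
                IsOfHodgeType (2 * (m + 1)) X (2 * (m + 1)) (m + 1) (m + 1) (conjEnd σ z c) ∧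
                  conjEnd σ z c ≠ 0) →
        ∀ e : complexBetti X (2 * (m + 1)), IsRationalClass e →
          IsOfHodgeType (2 * (m + 1)) X (2 * (m + 1)) (m + 1) (m + 1) e →
          ε e ∈ algebraicClasses X (m + 1))
    (c : complexBetti X (2 * (m + 1))) (hc : IsRationalClass c)
    (hH : IsOfHodgeType (2 * (m + 1)) X (2 * (m + 1)) (m + 1) (m + 1) c) :
    c ∈ algebraicClasses X (m + 1) := by
  classical
  -- the ℚ-blocks of the Hecke algebra (landed, p87916)
  obtain ⟨s, hblk, -, hsum⟩ := stub_rationalBlocks m X D hm1 hm2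
  -- `c = Σ_ε ε c`
  have hc_sum : c = ∑ ε ∈ s, ε c := by
    conv_lhs => rw [show c = (∑ ε ∈ s, ε) c by rw [hsum]; rfl]
    rw [LinearMap.sum_apply]
  rw [hc_sum]
  refine Submodule.sum_mem _ fun ε hε ↦ ?_
  obtain ⟨h1, h2, h3, h4, h5⟩ := hblk ε hε
  by_cases hpure : ∀ β, IsOfHodgeType (2 * (m + 1)) X (2 * (m + 1)) (m + 1) (m + 1) (ε β)
  · -- a PURE block: the first hypothesis
    exact hPure ε h1 h2 h3 h4 (fun p q x hx ↦ heckeHodgeType D h1 x hx) h5 hpure c hc hH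
  · by_cases hK : ∀ z : Module.End ℂ (complexBetti X (2 * (m + 1))),
        IsPrimitiveCentralIdempotent
            (Algebra.adjoin ℂ (Set.range (D.heckeCorrespondenceAction (2 * (m + 1))))) z →
          z * ε = z →
            ∃ σ : ℂ ≃+* ℂ, ∀ c : complexBetti X (2 * (m + 1)),
              IsOfHodgeType (2 * (m + 1)) X (2 * (m + 1)) (m + 1) (m + 1) (conjEnd σ z c) →
                conjEnd σ z c = 0
    · -- a KILLED impure block: `ε c = 0` by the sieve
      rw [stub_killedBarren m X D hm1 hm2 (fun a ha x hx ↦ heckeHodgeType D ha x hx) ε h1 h2 h3 hK c hc hH]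
      exact zero_mem _
    · -- a CORE: the bet
      push Not at hK
      exact hCore ε h1 h2 h3 h4 (fun p q x hx ↦ heckeHodgeType D h1 x hx) h5 (not_forall.1 hpure) hK c hc hH

/-! ## The target from the two blockwise statements, and back -/

/-- **`PureBlockHodgeClassesAlgebraic ∧ CoreHodgeClassesAlgebraic ⟹ MiddleDegreeStep`.** The first hypothesis is HC for the
classes `ε e` of the PURE ℚ-blocks `ε` of the Hecke algebra (`ε β` of type `(n,n)` for every `β`); the second is VERBATIM the
registered bet `stub_coreHodgeClassesAlgebraic` of line `core-splitting-ladder` (HC for the classes `ε e` of the CORES). The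
conclusion is the route's target by name. [cite: BergeronMillsonMoeglin2016Balls, Part 2 §1.9 and Thm. 61]
[cite: ArancibiaMoeglinRenard2015, §8] -/
theorem middleDegreeStep_of_blocks
    (hPure : ∀ (m : ℕ) (X : SchemeOver ℂ) (D : UnitaryBallQuotientDatum (2 * (m + 1)) X), 1 ≤ m → m ≤ 2 →
      (∀ a : complexBetti X (2 * m), IsRationalClass a →
        IsOfHodgeType (2 * (m + 1)) X (2 * m) m m a → a ∈ algebraicClasses X m) →
      ∀ ε : Module.End ℂ (complexBetti X (2 * (m + 1))),
        ε ∈ Algebra.adjoin ℂ (Set.range (D.heckeCorrespondenceAction (2 * (m + 1)))) →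
        ε * ε = ε →
        (∀ T ∈ Algebra.adjoin ℂ (Set.range (D.heckeCorrespondenceAction (2 * (m + 1)))),
          T * ε = ε * T) →
        (∀ β, IsRationalClass β → IsRationalClass (ε β)) →
        (∀ (p q : ℕ) (x : complexBetti X (2 * (m + 1))), IsOfHodgeType (2 * (m + 1)) X (2 * (m + 1)) p q x →
          IsOfHodgeType (2 * (m + 1)) X (2 * (m + 1)) p q (ε x)) →
        (∀ f ∈ Algebra.adjoin ℂ (Set.range (D.heckeCorrespondenceAction (2 * (m + 1)))),
          f * f = f →
          (∀ T ∈ Algebra.adjoin ℂ (Set.range (D.heckeCorrespondenceAction (2 * (m + 1)))),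
            T * f = f * T) →
          (∀ β, IsRationalClass β → IsRationalClass (f β)) → f * ε = 0 ∨ f * ε = ε) →
        (∀ β, IsOfHodgeType (2 * (m + 1)) X (2 * (m + 1)) (m + 1) (m + 1) (ε β)) →
        ∀ e : complexBetti X (2 * (m + 1)), IsRationalClass e →
          IsOfHodgeType (2 * (m + 1)) X (2 * (m + 1)) (m + 1) (m + 1) e →
          ε e ∈ algebraicClasses X (m + 1))
    (hCore : ∀ (m : ℕ) (X : SchemeOver ℂ) (D : UnitaryBallQuotientDatum (2 * (m + 1)) X), 1 ≤ m → m ≤ 2 →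
      (∀ a : complexBetti X (2 * m), IsRationalClass a →
        IsOfHodgeType (2 * (m + 1)) X (2 * m) m m a → a ∈ algebraicClasses X m) →
      ∀ ε : Module.End ℂ (complexBetti X (2 * (m + 1))),
        ε ∈ Algebra.adjoin ℂ (Set.range (D.heckeCorrespondenceAction (2 * (m + 1)))) →
        ε * ε = ε →
        (∀ T ∈ Algebra.adjoin ℂ (Set.range (D.heckeCorrespondenceAction (2 * (m + 1)))),
          T * ε = ε * T) →
        (∀ β, IsRationalClass β → IsRationalClass (ε β)) →
        (∀ (p q : ℕ) (x : complexBetti X (2 * (m + 1))), IsOfHodgeType (2 * (m + 1)) X (2 * (m + 1)) p q x →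
          IsOfHodgeType (2 * (m + 1)) X (2 * (m + 1)) p q (ε x)) →
        (∀ f ∈ Algebra.adjoin ℂ (Set.range (D.heckeCorrespondenceAction (2 * (m + 1)))),
          f * f = f →
          (∀ T ∈ Algebra.adjoin ℂ (Set.range (D.heckeCorrespondenceAction (2 * (m + 1)))),
            T * f = f * T) →
          (∀ β, IsRationalClass β → IsRationalClass (f β)) → f * ε = 0 ∨ f * ε = ε) →
        (∃ β, ¬ IsOfHodgeType (2 * (m + 1)) X (2 * (m + 1)) (m + 1) (m + 1) (ε β)) →
        (∃ z : Module.End ℂ (complexBetti X (2 * (m + 1))),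
          IsPrimitiveCentralIdempotent
              (Algebra.adjoin ℂ (Set.range (D.heckeCorrespondenceAction (2 * (m + 1))))) z ∧
            z * ε = z ∧
              ∀ σ : ℂ ≃+* ℂ, ∃ c : complexBetti X (2 * (m + 1)),
                IsOfHodgeType (2 * (m + 1)) X (2 * (m + 1)) (m + 1) (m + 1) (conjEnd σ z c) ∧
                  conjEnd σ z c ≠ 0) →
        ∀ e : complexBetti X (2 * (m + 1)), IsRationalClass e →
          IsOfHodgeType (2 * (m + 1)) X (2 * (m + 1)) (m + 1) (m + 1) e →
          ε e ∈ algebraicClasses X (m + 1)) :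
    MiddleDegreeStep := by
  intro m X hm1 hm2 hD hlow c hc hH
  obtain ⟨D⟩ := hD
  exact mem_algebraicClasses_of_pure_of_cores D hm1 hm2 (hPure m X D hm1 hm2 hlow) (hCore m X D hm1 hm2 hlow) c hc hH

/-- **`MiddleDegreeStep ⟹ PureBlockHodgeClassesAlgebraic`**: the pure half is HC-implied (two lines: `ε e` is rational by the
ℚ-block property and of type `(n,n)` by type preservation), exactly like the bet (`coreHodgeClassesAlgebraic_of_middleDegreeStep`,
p117875). [cite: BergeronMillsonMoeglin2016Balls, Part 2 §1.9] -/
theorem pureBlockHodgeClassesAlgebraic_of_middleDegreeStep (h : MiddleDegreeStep) :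
    ∀ (m : ℕ) (X : SchemeOver ℂ) (D : UnitaryBallQuotientDatum (2 * (m + 1)) X), 1 ≤ m → m ≤ 2 →
      (∀ a : complexBetti X (2 * m), IsRationalClass a →
        IsOfHodgeType (2 * (m + 1)) X (2 * m) m m a → a ∈ algebraicClasses X m) →
      ∀ ε : Module.End ℂ (complexBetti X (2 * (m + 1))),
        ε ∈ Algebra.adjoin ℂ (Set.range (D.heckeCorrespondenceAction (2 * (m + 1)))) →
        ε * ε = ε →
        (∀ T ∈ Algebra.adjoin ℂ (Set.range (D.heckeCorrespondenceAction (2 * (m + 1)))),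
          T * ε = ε * T) →
        (∀ β, IsRationalClass β → IsRationalClass (ε β)) →
        (∀ (p q : ℕ) (x : complexBetti X (2 * (m + 1))), IsOfHodgeType (2 * (m + 1)) X (2 * (m + 1)) p q x →
          IsOfHodgeType (2 * (m + 1)) X (2 * (m + 1)) p q (ε x)) →
        (∀ f ∈ Algebra.adjoin ℂ (Set.range (D.heckeCorrespondenceAction (2 * (m + 1)))),
          f * f = f →
          (∀ T ∈ Algebra.adjoin ℂ (Set.range (D.heckeCorrespondenceAction (2 * (m + 1)))),
            T * f = f * T) →
          (∀ β, IsRationalClass β → IsRationalClass (f β)) → f * ε = 0 ∨ f * ε = ε) →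
        (∀ β, IsOfHodgeType (2 * (m + 1)) X (2 * (m + 1)) (m + 1) (m + 1) (ε β)) →
        ∀ e : complexBetti X (2 * (m + 1)), IsRationalClass e →
          IsOfHodgeType (2 * (m + 1)) X (2 * (m + 1)) (m + 1) (m + 1) e →
          ε e ∈ algebraicClasses X (m + 1) := by
  intro m X D hm1 hm2 hlow ε _ _ _ h4 hεH _ _ e he heH
  exact h m X hm1 hm2 ⟨D⟩ hlow (ε e) (h4 e he) (hεH _ _ e heH)

/-- **`MiddleDegreeStep ⟺ PureBlockHodgeClassesAlgebraic ∧ CoreHodgeClassesAlgebraic`** (fact-free): the route's target — HC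
in the middle degree of compact 4- and 6-ball quotients granted HC one degree down — IS the conjunction of HC for the classes of the
pure ℚ-Hecke blocks and HC for the classes of the Hecke cores (the registered bet of line `core-splitting-ladder`, verbatim).
[cite: BergeronMillsonMoeglin2016Balls, Part 2 §1.9 and Thm. 61] [cite: ArancibiaMoeglinRenard2015, §8] -/
theorem middleDegreeStep_iff_blocks :
    MiddleDegreeStep ↔
    ((∀ (m : ℕ) (X : SchemeOver ℂ) (D : UnitaryBallQuotientDatum (2 * (m + 1)) X), 1 ≤ m → m ≤ 2 →
      (∀ a : complexBetti X (2 * m), IsRationalClass a →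
        IsOfHodgeType (2 * (m + 1)) X (2 * m) m m a → a ∈ algebraicClasses X m) →
      ∀ ε : Module.End ℂ (complexBetti X (2 * (m + 1))),
        ε ∈ Algebra.adjoin ℂ (Set.range (D.heckeCorrespondenceAction (2 * (m + 1)))) →
        ε * ε = ε →
        (∀ T ∈ Algebra.adjoin ℂ (Set.range (D.heckeCorrespondenceAction (2 * (m + 1)))),
          T * ε = ε * T) →
        (∀ β, IsRationalClass β → IsRationalClass (ε β)) →
        (∀ (p q : ℕ) (x : complexBetti X (2 * (m + 1))), IsOfHodgeType (2 * (m + 1)) X (2 * (m + 1)) p q x →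
          IsOfHodgeType (2 * (m + 1)) X (2 * (m + 1)) p q (ε x)) →
        (∀ f ∈ Algebra.adjoin ℂ (Set.range (D.heckeCorrespondenceAction (2 * (m + 1)))),
          f * f = f →
          (∀ T ∈ Algebra.adjoin ℂ (Set.range (D.heckeCorrespondenceAction (2 * (m + 1)))),
            T * f = f * T) →
          (∀ β, IsRationalClass β → IsRationalClass (f β)) → f * ε = 0 ∨ f * ε = ε) →
        (∀ β, IsOfHodgeType (2 * (m + 1)) X (2 * (m + 1)) (m + 1) (m + 1) (ε β)) →
        ∀ e : complexBetti X (2 * (m + 1)), IsRationalClass e →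
          IsOfHodgeType (2 * (m + 1)) X (2 * (m + 1)) (m + 1) (m + 1) e →
          ε e ∈ algebraicClasses X (m + 1)) ∧
    (∀ (m : ℕ) (X : SchemeOver ℂ) (D : UnitaryBallQuotientDatum (2 * (m + 1)) X), 1 ≤ m → m ≤ 2 →
      (∀ a : complexBetti X (2 * m), IsRationalClass a →
        IsOfHodgeType (2 * (m + 1)) X (2 * m) m m a → a ∈ algebraicClasses X m) →
      ∀ ε : Module.End ℂ (complexBetti X (2 * (m + 1))),
        ε ∈ Algebra.adjoin ℂ (Set.range (D.heckeCorrespondenceAction (2 * (m + 1)))) →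
        ε * ε = ε →
        (∀ T ∈ Algebra.adjoin ℂ (Set.range (D.heckeCorrespondenceAction (2 * (m + 1)))),
          T * ε = ε * T) →
        (∀ β, IsRationalClass β → IsRationalClass (ε β)) →
        (∀ (p q : ℕ) (x : complexBetti X (2 * (m + 1))), IsOfHodgeType (2 * (m + 1)) X (2 * (m + 1)) p q x →
          IsOfHodgeType (2 * (m + 1)) X (2 * (m + 1)) p q (ε x)) →
        (∀ f ∈ Algebra.adjoin ℂ (Set.range (D.heckeCorrespondenceAction (2 * (m + 1)))),
          f * f = f →
          (∀ T ∈ Algebra.adjoin ℂ (Set.range (D.heckeCorrespondenceAction (2 * (m + 1)))),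
            T * f = f * T) →
          (∀ β, IsRationalClass β → IsRationalClass (f β)) → f * ε = 0 ∨ f * ε = ε) →
        (∃ β, ¬ IsOfHodgeType (2 * (m + 1)) X (2 * (m + 1)) (m + 1) (m + 1) (ε β)) →
        (∃ z : Module.End ℂ (complexBetti X (2 * (m + 1))),
          IsPrimitiveCentralIdempotent
              (Algebra.adjoin ℂ (Set.range (D.heckeCorrespondenceAction (2 * (m + 1))))) z ∧
            z * ε = z ∧
              ∀ σ : ℂ ≃+* ℂ, ∃ c : complexBetti X (2 * (m + 1)),
                IsOfHodgeType (2 * (m + 1)) X (2 * (m + 1)) (m + 1) (m + 1) (conjEnd σ z c) ∧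
                  conjEnd σ z c ≠ 0) →
        ∀ e : complexBetti X (2 * (m + 1)), IsRationalClass e →
          IsOfHodgeType (2 * (m + 1)) X (2 * (m + 1)) (m + 1) (m + 1) e →
          ε e ∈ algebraicClasses X (m + 1))) :=
  ⟨fun h ↦ ⟨pureBlockHodgeClassesAlgebraic_of_middleDegreeStep h, coreHodgeClassesAlgebraic_of_middleDegreeStep h⟩,
    fun h ↦ middleDegreeStep_of_blocks h.1 h.2⟩

/-! ## The pure half from the route's other live crux -/

/-- **`IsotypicMiddleClassesAlgebraic ⟹ PureBlockHodgeClassesAlgebraic`.** A pure ℚ-block `ε` of the Hecke algebra is the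
action `P_γ` of an ALGEBRAIC class `γ ∈ algebraicClasses (X ⊗ X) (2n)` at the complex orientation family
(`exists_algebraic_corrAction_eq_of_mem_adjoin`, `exists_orientationFamily_hasPoincareDuality`); `P_γ = ε` preserves rational classes
(ℚ-block), is `(n,n)`-valued (purity) and fixes `ε e` (idempotency), and `ε e` is rational — so stmt-HodgeConjecture-14301 makes
`ε e` algebraic. (`hlow`, type preservation, primitivity are idle here.) [cite: BergeronMillsonMoeglin2016Balls, Part 2 §1.8 and Thm. 61]
[cite: Shimura1971, §3.1] -/
theorem pureBlockHodgeClassesAlgebraic_of_isotypicMiddle (h : IsotypicMiddleClassesAlgebraic) :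
    ∀ (m : ℕ) (X : SchemeOver ℂ) (D : UnitaryBallQuotientDatum (2 * (m + 1)) X), 1 ≤ m → m ≤ 2 →
      (∀ a : complexBetti X (2 * m), IsRationalClass a →
        IsOfHodgeType (2 * (m + 1)) X (2 * m) m m a → a ∈ algebraicClasses X m) →
      ∀ ε : Module.End ℂ (complexBetti X (2 * (m + 1))),
        ε ∈ Algebra.adjoin ℂ (Set.range (D.heckeCorrespondenceAction (2 * (m + 1)))) →
        ε * ε = ε →
        (∀ T ∈ Algebra.adjoin ℂ (Set.range (D.heckeCorrespondenceAction (2 * (m + 1)))),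
          T * ε = ε * T) →
        (∀ β, IsRationalClass β → IsRationalClass (ε β)) →
        (∀ (p q : ℕ) (x : complexBetti X (2 * (m + 1))), IsOfHodgeType (2 * (m + 1)) X (2 * (m + 1)) p q x →
          IsOfHodgeType (2 * (m + 1)) X (2 * (m + 1)) p q (ε x)) →
        (∀ f ∈ Algebra.adjoin ℂ (Set.range (D.heckeCorrespondenceAction (2 * (m + 1)))),
          f * f = f →
          (∀ T ∈ Algebra.adjoin ℂ (Set.range (D.heckeCorrespondenceAction (2 * (m + 1)))),
            T * f = f * T) →
          (∀ β, IsRationalClass β → IsRationalClass (f β)) → f * ε = 0 ∨ f * ε = ε) →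
        (∀ β, IsOfHodgeType (2 * (m + 1)) X (2 * (m + 1)) (m + 1) (m + 1) (ε β)) →
        ∀ e : complexBetti X (2 * (m + 1)), IsRationalClass e →
          IsOfHodgeType (2 * (m + 1)) X (2 * (m + 1)) (m + 1) (m + 1) e →
          ε e ∈ algebraicClasses X (m + 1) := by
  intro m X D hm1 hm2 _ ε h1 h2 _ h4 _ _ hpure e he _
  obtain ⟨μ, hμ⟩ := exists_orientationFamily_hasPoincareDuality
  obtain ⟨γ, hγ, hPγ⟩ := exists_algebraic_corrAction_eq_of_mem_adjoin hμ D hm1 hm2 h1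
  -- `P_γ β = ε β` (the inline `let P` of the crux is `corrAction μ … γ` by `rfl`)
  have hPβ : ∀ β : complexBetti X (2 * (m + 1)),
      complexGysin μ (IsSmoothProjective.tensor_holds D.isSmoothProjective D.isSmoothProjective)
        D.isSmoothProjective (fst X X)
        (show 2 * (m + 1) + 2 * (2 * (m + 1)) + 2 * (2 * (m + 1)) = 2 * (m + 1) + 2 * (2 * (m + 1) + 2 * (m + 1)) by ring)
        (cupProduct (rfl : 2 * (m + 1) + 2 * (2 * (m + 1)) = 2 * (m + 1) + 2 * (2 * (m + 1)))
          (complexBetti.map (snd X X) (2 * (m + 1)) β) γ) = ε β := fun β ↦ by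
    change corrAction μ D.isSmoothProjective D.isSmoothProjective
      (rfl : 2 * (m + 1) + 2 * (2 * (m + 1)) = 2 * (m + 1) + 2 * (2 * (m + 1))) γ β = _
    rw [hPγ]
  refine h μ hμ m X D hm1 hm2 γ hγ (fun β hβ ↦ ?_) (fun β ↦ ?_) (ε e) (h4 e he) ?_
  · beta_reduce; rw [hPβ]; exact h4 β hβ
  · beta_reduce; rw [hPβ]; exact hpure β
  · beta_reduce; rw [hPβ, ← Module.End.mul_apply, h2]

/-- **Target ⟸ 14301 ∧ bet, directly.** `MiddleDegreeStep` from `IsotypicMiddleClassesAlgebraic` (stmt-HodgeConjecture-14301)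
and the registered bet `stub_coreHodgeClassesAlgebraic` (verbatim), by the blockwise decomposition — without `AlgebraicOrEnveloped`,
`OrthogonalEnveloped`, `OrthogonalSplit`, `CupProductAlgebraic` or any orientation-family hypothesis (compare the route's
`closes h₁ (algebraicOrEnveloped_of_bet hB) hS`). [cite: BergeronMillsonMoeglin2016Balls, Part 2 §1.9 and Thm. 61]
[cite: ArancibiaMoeglinRenard2015, §8] -/
theorem middleDegreeStep_of_isotypicMiddle_of_bet (h₁ : IsotypicMiddleClassesAlgebraic)
    (hCore : ∀ (m : ℕ) (X : SchemeOver ℂ) (D : UnitaryBallQuotientDatum (2 * (m + 1)) X), 1 ≤ m → m ≤ 2 →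
      (∀ a : complexBetti X (2 * m), IsRationalClass a →
        IsOfHodgeType (2 * (m + 1)) X (2 * m) m m a → a ∈ algebraicClasses X m) →
      ∀ ε : Module.End ℂ (complexBetti X (2 * (m + 1))),
        ε ∈ Algebra.adjoin ℂ (Set.range (D.heckeCorrespondenceAction (2 * (m + 1)))) →
        ε * ε = ε →
        (∀ T ∈ Algebra.adjoin ℂ (Set.range (D.heckeCorrespondenceAction (2 * (m + 1)))),
          T * ε = ε * T) →
        (∀ β, IsRationalClass β → IsRationalClass (ε β)) →
        (∀ (p q : ℕ) (x : complexBetti X (2 * (m + 1))), IsOfHodgeType (2 * (m + 1)) X (2 * (m + 1)) p q x →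
          IsOfHodgeType (2 * (m + 1)) X (2 * (m + 1)) p q (ε x)) →
        (∀ f ∈ Algebra.adjoin ℂ (Set.range (D.heckeCorrespondenceAction (2 * (m + 1)))),
          f * f = f →
          (∀ T ∈ Algebra.adjoin ℂ (Set.range (D.heckeCorrespondenceAction (2 * (m + 1)))),
            T * f = f * T) →
          (∀ β, IsRationalClass β → IsRationalClass (f β)) → f * ε = 0 ∨ f * ε = ε) →
        (∃ β, ¬ IsOfHodgeType (2 * (m + 1)) X (2 * (m + 1)) (m + 1) (m + 1) (ε β)) →
        (∃ z : Module.End ℂ (complexBetti X (2 * (m + 1))),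
          IsPrimitiveCentralIdempotent
              (Algebra.adjoin ℂ (Set.range (D.heckeCorrespondenceAction (2 * (m + 1))))) z ∧
            z * ε = z ∧
              ∀ σ : ℂ ≃+* ℂ, ∃ c : complexBetti X (2 * (m + 1)),
                IsOfHodgeType (2 * (m + 1)) X (2 * (m + 1)) (m + 1) (m + 1) (conjEnd σ z c) ∧
                  conjEnd σ z c ≠ 0) →
        ∀ e : complexBetti X (2 * (m + 1)), IsRationalClass e →
          IsOfHodgeType (2 * (m + 1)) X (2 * (m + 1)) (m + 1) (m + 1) e →
          ε e ∈ algebraicClasses X (m + 1)) :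
    MiddleDegreeStep :=
  middleDegreeStep_of_blocks (pureBlockHodgeClassesAlgebraic_of_isotypicMiddle h₁) hCore

end Summit.HodgeConjecture.HodgeConjecture.Theorems.CoreSplittingLadder

end
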